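import Summits.Ventures.Crystal3D.Theorems.StickyWulffConstantGenericWallFloorDockedMenu
import HarnessLib

/-!
# The END-BALL UNIVERSE LEMMA: around a certified end ball every ball within `√3` is on the DOCKED MENU of
# the grain or carries a payer (crux `GenericWallFloor`, stmt-Ventures-19480, line `WallLedgerG`; cf-p1 ORDER 2026-08-28T20:38Z (1))

HONEST FRAMING. Venture `Summits/Ventures/Crystal3D` (cell `crystal3d-full`), helper `--supports` the crux `GenericWallFloor`
of `route-Ventures-StickyWulffConstant`, REGISTERED line `WallLedgerG`, open stub `stub_twoSlabAdhesion`.  Rung credit only;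
F-C1 not moved; NOT the crux.  Census-free, standard axioms; the kissing facts `KissingGap δ`, `KissingClassification δ`
(`δ ≥ 5/2`) enter §4 as hypotheses exactly like `…SaturationStructure` / `…DockedExact`.

THE CHAIN «dichotomy ⇒ docked data ⇒ three independent touching slots ⇒ `dockedMenu_holds`» CLOSED (memo STRUCTURAL-GLUE-g10
§3(3); cf-p1 §86(156)): the one missing link was the COUNT supplying `DockedMenu`'s three shared neighbours.
* §1 `linearIndependent_of_unit_of_inner_eq` — three distinct unit vectors making the same non-zero inner product with one
  vector are linearly independent (three points of a circle off the origin).  This replaces the planned «48 + 48 determinant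
  checks»: the touching slot neighbours `q` of a docked end ball `z` (docking ball `s`) all satisfy `⟪q − z, s − z⟫ = ½`.
* §2 `four_le_card_adjacent_fccInt/hcpInt` (`decide`, 144 cases each) and the real form `four_le_card_touching_of_dozen`: in a
  close-packed dozen `{s + B p}` through `z`, at least four dozen balls touch `z`.
* §3 **`exists_three_touching_slots`** (the COUNT): if `z` has `k` certified slot contacts `z + A w` (`w ∈ S ⊆ fccSlots`) and at
  most `k + 1` contacts in all, then for every docking ball `s` (twelve-ball close-packed dozen through `z`) three linearly
  independent certified slots touch `s` (`k + 4 − deg z ≥ 3`).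
* §4 **`menu_or_payer_of_near_endBall`** (THE UNIVERSE LEMMA): GAP/CLASSIFICATION at `δ ≥ 5/2`, `X` `1`-separated, `z ∈ X` with
  `k` certified slot contacts of the frame `A` and `deg z ≤ k + 1`.  Then every `x ∈ X`, `x ≠ z`, `dist x z ≤ √3` EITHER has a
  payer `y ≠ z` within `2` (`deg y ≤ 11`), OR lies on the DOCKED MENU: `x = (z − v′) [+ v]` with `v′, v` in ONE exact dozen `D`
  of the grain — `D = A(fccSlots)` or one of the eight twin dozens `{A w : ⟪A w,n⟫ ≤ 0} ∪ {A w − 2⟪A w,n⟫ n : ⟪A w,n⟫ < 0}` —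
  where `z − v′ ∈ X` is twelve-touched with contacts exactly `z − v′ + D`.  `allOnMenu_or_payer_near_endBall`: per end ball,
  all of the `√3`-neighbourhood is on the menu or a payer sits within `2 + √3` of `z` (multiplicity ≤ 606, …PayerMultiplicity).
The integer TABLE of the menu (146 relative positions within `√3`, cubic coordinates in `(1/3)ℤ³`) is the sequel
`…EndBallMenuDefs` / `…EndBallMenuTable`.
WHAT THIS IS NOT: no enumeration of classes, no ledger; `deg z ≤ k + 1` is a HYPOTHESIS (all-exact classes have `deg z = k`;
two or more uncertified contacts are the registered residual); F-C1 not moved.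
-/

noncomputable section

namespace Summit.Ventures.Crystal3D.Theorems

open Summit.Ventures.Crystal3D Finset
open Literature.Geometry.DiscreteGeometry (fccKissingPattern hcpKissingPattern fccInt hcpInt intVec intVec_sub sqNormInt
  norm_intVec scaledPattern scaledPattern_map_injective)
open scoped InnerProductSpace

variable {X : Finset (EuclideanSpace ℝ (Fin 3))}

/-! ### §1 Three distinct unit vectors on a circle off the origin are linearly independent -/

/-- **Circle lemma.**  Three distinct unit vectors `u₁, u₂, u₃` with `⟪uᵢ, e⟫ = c ≠ 0` for one vector `e` are linearly
independent (a vanishing combination has coefficient sum `0` by pairing with `e`; then strict convexity of the sphere). -/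
theorem linearIndependent_of_unit_of_inner_eq {u₁ u₂ u₃ e : EuclideanSpace ℝ (Fin 3)}
    (h₁ : ‖u₁‖ = 1) (h₂ : ‖u₂‖ = 1) (h₃ : ‖u₃‖ = 1) {c : ℝ} (hc : c ≠ 0)
    (he₁ : ⟪u₁, e⟫_ℝ = c) (he₂ : ⟪u₂, e⟫_ℝ = c) (he₃ : ⟪u₃, e⟫_ℝ = c)
    (h₁₂ : u₁ ≠ u₂) (h₁₃ : u₁ ≠ u₃) (h₂₃ : u₂ ≠ u₃) : LinearIndependent ℝ ![u₁, u₂, u₃] := by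
  have n1 : ⟪u₁, u₁⟫_ℝ = 1 := by rw [real_inner_self_eq_norm_sq, h₁, one_pow]
  have n2 : ⟪u₂, u₂⟫_ℝ = 1 := by rw [real_inner_self_eq_norm_sq, h₂, one_pow]
  have n3 : ⟪u₃, u₃⟫_ℝ = 1 := by rw [real_inner_self_eq_norm_sq, h₃, one_pow]
  have a12 : ⟪u₁, u₂⟫_ℝ < 1 := (inner_lt_one_iff_real_of_norm_eq_one h₁ h₂).2 h₁₂
  have a13 : ⟪u₁, u₃⟫_ℝ < 1 := (inner_lt_one_iff_real_of_norm_eq_one h₁ h₃).2 h₁₃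
  have a23 : ⟪u₂, u₃⟫_ℝ < 1 := (inner_lt_one_iff_real_of_norm_eq_one h₂ h₃).2 h₂₃
  have s21 : ⟪u₂, u₁⟫_ℝ = ⟪u₁, u₂⟫_ℝ := real_inner_comm _ _
  have s31 : ⟪u₃, u₁⟫_ℝ = ⟪u₁, u₃⟫_ℝ := real_inner_comm _ _
  have s32 : ⟪u₃, u₂⟫_ℝ = ⟪u₂, u₃⟫_ℝ := real_inner_comm _ _
  rw [Fintype.linearIndependent_iff]
  intro g hg
  simp only [Fin.sum_univ_three, Matrix.cons_val_zero, Matrix.cons_val_one, Matrix.cons_val] at hg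
  have e0 := congrArg (fun v => ⟪v, e⟫_ℝ) hg
  have e1 := congrArg (fun v => ⟪v, u₁⟫_ℝ) hg
  have e2 := congrArg (fun v => ⟪v, u₂⟫_ℝ) hg
  have e3 := congrArg (fun v => ⟪v, u₃⟫_ℝ) hg
  simp only [inner_add_left, real_inner_smul_left, inner_zero_left, he₁, he₂, he₃, n1, n2, n3, s21, s31, s32] at e0 e1 e2 e3
  have hsum : g 0 + g 1 + g 2 = 0 := by
    have h : (g 0 + g 1 + g 2) * c = 0 := by linear_combination e0
    exact (mul_eq_zero.1 h).resolve_right hc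
  set a := ⟪u₁, u₂⟫_ℝ
  set b := ⟪u₁, u₃⟫_ℝ
  set d := ⟪u₂, u₃⟫_ℝ
  have f1 : g 1 * (1 - a) + g 2 * (1 - b) = 0 := by linear_combination hsum - e1
  have f2 : g 0 * (1 - a) + g 2 * (1 - d) = 0 := by linear_combination hsum - e2
  have f3 : g 0 * (1 - b) + g 1 * (1 - d) = 0 := by linear_combination hsum - e3
  have k1 : (1 - d) * (g 2 * (1 - b) - g 1 * (1 - a)) = 0 := by linear_combination (1 - b) * f2 - (1 - a) * f3
  have k2 : g 2 * (1 - b) - g 1 * (1 - a) = 0 :=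
    (mul_eq_zero.1 k1).resolve_left (by linarith)
  have hg2 : g 2 = 0 := by
    have : g 2 * (2 * (1 - b)) = 0 := by linear_combination f1 + k2
    exact (mul_eq_zero.1 this).resolve_right (by linarith)
  have hg1 : g 1 = 0 := by
    have : g 1 * (1 - a) = 0 := by linear_combination f1 - (1 - b) * hg2
    exact (mul_eq_zero.1 this).resolve_right (by linarith)
  have hg0 : g 0 = 0 := by linarith
  intro i
  fin_cases i
  · exact hg0
  · exact hg1
  · exact hg2

/-- **Touching neighbours of a docked ball are independent.**  If `q₁, q₂, q₃` are distinct, touch `z`, and touch a ball `s`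
touching `z`, then `q₁ − z, q₂ − z, q₃ − z` are linearly independent (`⟪qᵢ − z, s − z⟫ = ½`). -/
theorem linearIndependent_sub_of_touching {z s q₁ q₂ q₃ : EuclideanSpace ℝ (Fin 3)} (hsz : dist s z = 1)
    (hz₁ : dist q₁ z = 1) (hz₂ : dist q₂ z = 1) (hz₃ : dist q₃ z = 1)
    (hs₁ : dist s q₁ = 1) (hs₂ : dist s q₂ = 1) (hs₃ : dist s q₃ = 1)
    (h₁₂ : q₁ ≠ q₂) (h₁₃ : q₁ ≠ q₃) (h₂₃ : q₂ ≠ q₃) :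
    LinearIndependent ℝ ![q₁ - z, q₂ - z, q₃ - z] := by
  have half : ∀ q : EuclideanSpace ℝ (Fin 3), dist q z = 1 → dist s q = 1 → ⟪q - z, s - z⟫_ℝ = 1 / 2 := by
    intro q hqz hsq
    have h1 : ‖q - z‖ = 1 := by rw [← dist_eq_norm, hqz]
    have h2 : ‖s - z‖ = 1 := by rw [← dist_eq_norm, hsz]
    have h3 : ‖(q - z) - (s - z)‖ = 1 := by rw [sub_sub_sub_cancel_right, ← dist_eq_norm, dist_comm, hsq]
    have key : ‖(q - z) - (s - z)‖ ^ 2 = ‖q - z‖ ^ 2 - 2 * ⟪q - z, s - z⟫_ℝ + ‖s - z‖ ^ 2 :=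
      norm_sub_sq_real _ _
    rw [h1, h2, h3] at key
    linarith
  refine linearIndependent_of_unit_of_inner_eq (e := s - z) (c := 1 / 2) ?_ ?_ ?_ (by norm_num)
    (half q₁ hz₁ hs₁) (half q₂ hz₂ hs₂) (half q₃ hz₃ hs₃) ?_ ?_ ?_
  · rw [← dist_eq_norm, hz₁]
  · rw [← dist_eq_norm, hz₂]
  · rw [← dist_eq_norm, hz₃]
  · exact fun h => h₁₂ (sub_left_injective h)
  · exact fun h => h₁₃ (sub_left_injective h)
  · exact fun h => h₂₃ (sub_left_injective h)

/-! ### §2 At least four balls of a close-packed dozen touch any given dozen ball -/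

/-- Cuboctahedron: every vertex has (at least) four adjacent vertices (integer model, squared edge `2`). -/
theorem four_le_card_adjacent_fccInt :
    ∀ v' ∈ fccInt, 4 ≤ (fccInt.filter fun v => sqNormInt (v - v') = 2).card := by decide

/-- Anticuboctahedron: every vertex has (at least) four adjacent vertices (integer model scaled by `3`, squared edge `18`). -/
theorem four_le_card_adjacent_hcpInt :
    ∀ v' ∈ hcpInt, 4 ≤ (hcpInt.filter fun v => sqNormInt (v - v') = 18).card := by decide

/-- Real form for a scaled integer pattern: adjacency count transfers along `v ↦ v/√N`. -/
theorem four_le_card_filter_dist_eq_one_scaledPattern {S : Finset (Fin 3 → ℤ)} {N : ℕ} (hN : N ≠ 0)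
    (h4 : ∀ v' ∈ S, 4 ≤ (S.filter fun v => sqNormInt (v - v') = N).card)
    {p' : EuclideanSpace ℝ (Fin 3)} (hp' : p' ∈ scaledPattern S N) :
    4 ≤ ((scaledPattern S N).filter fun p => dist p p' = 1).card := by
  classical
  obtain ⟨v', hv', rfl⟩ := Finset.mem_image.1 hp'
  have hpos : (0 : ℝ) < Real.sqrt N := by
    have : (0 : ℝ) < (N : ℝ) := by exact_mod_cast Nat.pos_of_ne_zero hN
    exact Real.sqrt_pos.2 this
  refine (h4 v' hv').trans (Finset.card_le_card_of_injOn (fun v => (Real.sqrt N)⁻¹ • intVec v) (fun v hv => ?_)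
    fun a _ b _ h => scaledPattern_map_injective hN h)
  have hv1 := Finset.mem_filter.1 (Finset.mem_coe.1 hv)
  refine Finset.mem_coe.2 (Finset.mem_filter.2 ⟨Finset.mem_image.2 ⟨v, hv1.1, rfl⟩, ?_⟩)
  rw [dist_eq_norm, ← smul_sub, intVec_sub, norm_smul, norm_inv, Real.norm_of_nonneg hpos.le, norm_intVec, hv1.2,
    Int.cast_natCast, inv_mul_cancel₀ hpos.ne']

/-- For the two kissing patterns: every pattern point has at least four pattern points at distance `1`. -/
theorem four_le_card_filter_dist_eq_one_pattern {P : Finset (EuclideanSpace ℝ (Fin 3))}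
    (hP : P = fccKissingPattern ∨ P = hcpKissingPattern) {p' : EuclideanSpace ℝ (Fin 3)} (hp' : p' ∈ P) :
    4 ≤ (P.filter fun p => dist p p' = 1).card := by
  rcases hP with rfl | rfl
  · exact four_le_card_filter_dist_eq_one_scaledPattern two_ne_zero
      (by simpa using four_le_card_adjacent_fccInt) hp'
  · exact four_le_card_filter_dist_eq_one_scaledPattern (by norm_num)
      (by simpa using four_le_card_adjacent_hcpInt) hp'

/-- **At least four dozen balls touch `z`.**  If the close-packed dozen `{s + B p : p ∈ P}` lies in `X` and `z = s + B p′` is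
one of its balls, then at least four balls of `X` touch both `z` and `s`. -/
theorem four_le_card_touching_of_dozen {P : Finset (EuclideanSpace ℝ (Fin 3))}
    (hP : P = fccKissingPattern ∨ P = hcpKissingPattern) {s z : EuclideanSpace ℝ (Fin 3)}
    (B : EuclideanSpace ℝ (Fin 3) →ₗᵢ[ℝ] EuclideanSpace ℝ (Fin 3)) (hocc : ∀ p ∈ P, s + B p ∈ X)
    {p' : EuclideanSpace ℝ (Fin 3)} (hp' : p' ∈ P) (hzp : z = s + B p') :
    4 ≤ (X.filter fun q => dist z q = 1 ∧ dist s q = 1).card := by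
  classical
  refine (four_le_card_filter_dist_eq_one_pattern hP hp').trans
    (Finset.card_le_card_of_injOn (fun p => s + B p) (fun p hp => ?_) fun a _ b _ h => B.injective (add_left_cancel h))
  have hp1 := Finset.mem_filter.1 (Finset.mem_coe.1 hp)
  refine Finset.mem_coe.2 (Finset.mem_filter.2 ⟨hocc p hp1.1, ?_, ?_⟩)
  · rw [hzp, dist_comm, dist_eq_norm, add_sub_add_left_eq_sub, ← map_sub, LinearIsometry.norm_map, ← dist_eq_norm, hp1.2]
  · rw [dist_eq_norm, sub_add_cancel_left, norm_neg, LinearIsometry.norm_map]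
    rcases hP with rfl | rfl
    · exact Literature.Geometry.DiscreteGeometry.norm_eq_one_of_mem_fccKissingPattern hp1.1
    · exact Literature.Geometry.DiscreteGeometry.norm_eq_one_of_mem_hcpKissingPattern hp1.1

/-! ### §3 The count: three linearly independent certified slots touch the docking ball -/

/-- **THE COUNT.**  `z ∈ X` carries `k = |S|` certified slot contacts `z + A w` (`w ∈ S ⊆ fccSlots`) and has at most `k + 1`
contacts in all; `{s + B p : p ∈ P}` (`P` the fcc or hcp pattern) is a close-packed dozen inside `X` through `z`.  Then three
certified slots `w₁, w₂, w₃ ∈ S`, linearly independent, have `z + A wᵢ` touching `s` — the hypothesis of `DockedMenu`. -/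
theorem exists_three_touching_slots (A : EuclideanSpace ℝ (Fin 3) ≃ₗᵢ[ℝ] EuclideanSpace ℝ (Fin 3))
    {z s : EuclideanSpace ℝ (Fin 3)} {P : Finset (EuclideanSpace ℝ (Fin 3))}
    (hP : P = fccKissingPattern ∨ P = hcpKissingPattern)
    (B : EuclideanSpace ℝ (Fin 3) →ₗᵢ[ℝ] EuclideanSpace ℝ (Fin 3)) (hocc : ∀ p ∈ P, s + B p ∈ X) (hsz : dist s z = 1)
    (hzP : ∃ p' ∈ P, z = s + B p')
    (S : Finset (EuclideanSpace ℝ (Fin 3))) (hS : ∀ w ∈ S, w ∈ fccSlots) (hSX : ∀ w ∈ S, z + A w ∈ X)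
    (hdeg : (X.filter fun q => dist z q = 1).card ≤ S.card + 1) :
    ∃ w₁ ∈ S, ∃ w₂ ∈ S, ∃ w₃ ∈ S, LinearIndependent ℝ ![w₁, w₂, w₃] ∧
      dist s (z + A w₁) = 1 ∧ dist s (z + A w₂) = 1 ∧ dist s (z + A w₃) = 1 := by
  classical
  obtain ⟨p', hp', hzp⟩ := hzP
  set N := X.filter fun q => dist z q = 1 with hN
  set C := X.filter fun q => dist z q = 1 ∧ dist s q = 1 with hC
  set S₀ := S.filter fun w => dist s (z + A w) ≠ 1 with hS₀
  set S₁ := S.filter fun w => dist s (z + A w) = 1 with hS₁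
  have hC4 : 4 ≤ C.card := four_le_card_touching_of_dozen hP B hocc hp' hzp
  have hφinj : Set.InjOn (fun w => z + A w) ↑S₀ := fun a _ b _ h => A.injective (add_left_cancel h)
  have hslotdist : ∀ w ∈ S, dist z (z + A w) = 1 := fun w hw => by
    rw [dist_eq_norm, sub_add_cancel_left, norm_neg, LinearIsometryEquiv.norm_map, norm_eq_one_of_mem_fccSlots (hS w hw)]
  -- the uncertified-or-not-touching part: `S₀ ↪ N \ C`
  have hsub : S₀.image (fun w => z + A w) ∪ C ⊆ N := by
    intro q hq
    rcases Finset.mem_union.1 hq with hq | hq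
    · obtain ⟨w, hw, rfl⟩ := Finset.mem_image.1 hq
      have hw' := (Finset.mem_filter.1 hw).1
      exact Finset.mem_filter.2 ⟨hSX w hw', hslotdist w hw'⟩
    · have hq' := Finset.mem_filter.1 hq
      exact Finset.mem_filter.2 ⟨hq'.1, hq'.2.1⟩
  have hdisj : Disjoint (S₀.image fun w => z + A w) C := by
    rw [Finset.disjoint_left]
    intro q hq hqC
    obtain ⟨w, hw, rfl⟩ := Finset.mem_image.1 hq
    exact (Finset.mem_filter.1 hw).2 (Finset.mem_filter.1 hqC).2.2
  have hcount : S₀.card + C.card ≤ N.card := by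
    calc S₀.card + C.card = (S₀.image fun w => z + A w).card + C.card := by rw [Finset.card_image_of_injOn hφinj]
      _ = (S₀.image (fun w => z + A w) ∪ C).card := (Finset.card_union_of_disjoint hdisj).symm
      _ ≤ N.card := Finset.card_le_card hsub
  have hsplit : S₀.card + S₁.card = S.card := by
    rw [hS₀, hS₁, add_comm]
    exact Finset.card_filter_add_card_filter_not _
  have h3 : 2 < S₁.card := by omega
  obtain ⟨w₁, w₂, w₃, hw₁, hw₂, hw₃, h12, h13, h23⟩ := Finset.two_lt_card_iff.1 h3
  have m₁ := Finset.mem_filter.1 hw₁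
  have m₂ := Finset.mem_filter.1 hw₂
  have m₃ := Finset.mem_filter.1 hw₃
  refine ⟨w₁, m₁.1, w₂, m₂.1, w₃, m₃.1, ?_, m₁.2, m₂.2, m₃.2⟩
  -- independence: the three touching neighbours lie on the circle `⟪q − z, s − z⟫ = ½`
  have hq : ∀ w ∈ S, (z + A w) - z = A w := fun w _ => add_sub_cancel_left z (A w)
  have hind : LinearIndependent ℝ ![(z + A w₁) - z, (z + A w₂) - z, (z + A w₃) - z] :=
    linearIndependent_sub_of_touching hsz (by rw [dist_comm]; exact hslotdist w₁ m₁.1)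
      (by rw [dist_comm]; exact hslotdist w₂ m₂.1) (by rw [dist_comm]; exact hslotdist w₃ m₃.1) m₁.2 m₂.2 m₃.2
      (fun h => h12 (A.injective (add_left_cancel h))) (fun h => h13 (A.injective (add_left_cancel h)))
      (fun h => h23 (A.injective (add_left_cancel h)))
  rw [hq w₁ m₁.1, hq w₂ m₂.1, hq w₃ m₃.1] at hind
  have := linearIndependent_map_triple A.symm hind
  simpa only [LinearIsometryEquiv.symm_apply_apply] using this

/-! ### §4 The universe lemma -/

/-- **THE END-BALL UNIVERSE LEMMA** («payer or docked menu»).  GAP(`δ`) ∧ CLASSIFICATION(`δ`), `δ ≥ 5/2`; `X` `1`-separated;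
`A` a grain frame; `z ∈ X` with certified slot contacts `z + A w`, `w ∈ S ⊆ fccSlots`, and at most `|S| + 1` contacts.  Then
every `x ∈ X`, `x ≠ z`, `dist x z ≤ √3` EITHER has a payer `y ∈ X`, `y ≠ z`, `dist x y ≤ 2`, with at most eleven contacts, OR
lies on the DOCKED MENU of the grain: there are an exact dozen `D` of the grain at the docking ball — `D = A(fccSlots)` or a
twin dozen `{A w : ⟪A w, n⟫ ≤ 0} ∪ {A w − 2⟪A w, n⟫ n : ⟪A w, n⟫ < 0}` for a unit `{111}` normal `n` of `A` — and `v′ ∈ D`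
such that the docking ball `z − v′ ∈ X` is twelve-touched, its contacts are exactly `z − v′ + D ⊆ X`, `dist x (z − v′) ≤ 1`,
and `x = z − v′` or `x = z − v′ + v` with `v ∈ D`. -/
theorem menu_or_payer_of_near_endBall {δ : ℝ} (hg : KissingGap δ) (hc : KissingClassification δ) (hδ : 5 / 2 ≤ δ)
    (hX : ∀ p ∈ X, ∀ q ∈ X, p ≠ q → 1 ≤ dist p q)
    (A : EuclideanSpace ℝ (Fin 3) ≃ₗᵢ[ℝ] EuclideanSpace ℝ (Fin 3)) {z : EuclideanSpace ℝ (Fin 3)} (hz : z ∈ X)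
    (S : Finset (EuclideanSpace ℝ (Fin 3))) (hS : ∀ w ∈ S, w ∈ fccSlots) (hSX : ∀ w ∈ S, z + A w ∈ X)
    (hdeg : (X.filter fun q => dist z q = 1).card ≤ S.card + 1)
    {x : EuclideanSpace ℝ (Fin 3)} (hx : x ∈ X) (hxz : x ≠ z) (h3 : dist x z ≤ Real.sqrt 3) :
    (∃ y ∈ X, y ≠ z ∧ dist x y ≤ 2 ∧ (X.filter fun q => dist y q = 1).card ≤ 11) ∨
    ∃ (D : Set (EuclideanSpace ℝ (Fin 3))) (v' : EuclideanSpace ℝ (Fin 3)),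
      (D = A '' (↑fccSlots : Set (EuclideanSpace ℝ (Fin 3))) ∨
        ∃ n : EuclideanSpace ℝ (Fin 3), ‖n‖ = 1 ∧
          (∀ w ∈ fccSlots, ⟪A w, n⟫_ℝ = 0 ∨ ⟪A w, n⟫_ℝ = Real.sqrt (2 / 3) ∨ ⟪A w, n⟫_ℝ = -Real.sqrt (2 / 3)) ∧
          D = (fun w => A w) '' {w | w ∈ fccSlots ∧ ⟪A w, n⟫_ℝ ≤ 0} ∪
            (fun w => A w - (2 * ⟪A w, n⟫_ℝ) • n) '' {w | w ∈ fccSlots ∧ ⟪A w, n⟫_ℝ < 0}) ∧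
      v' ∈ D ∧ z - v' ∈ X ∧ (X.filter fun q => dist (z - v') q = 1).card = 12 ∧
      (∀ v ∈ D, z - v' + v ∈ X) ∧ (∀ q ∈ X, dist (z - v') q = 1 → q - (z - v') ∈ D) ∧
      dist x (z - v') ≤ 1 ∧ (x = z - v' ∨ ∃ v ∈ D, x = z - v' + v) := by
  rcases payer_near_or_docked_hall_of_near_endBall hg hc hδ hX hz hx hxz h3 with h | h
  · exact Or.inl h
  right
  obtain ⟨s, hs, P, B, hP, hxs, hsz, hs12, hocc, hall, ⟨p', hp', hzp⟩, hxcase⟩ := h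
  obtain ⟨w₁, hw₁, w₂, hw₂, w₃, hw₃, hind, hd₁, hd₂, hd₃⟩ :=
    exists_three_touching_slots A hP B hocc hsz ⟨p', hp', hzp⟩ S hS hSX hdeg
  have hmenu := dockedMenu_holds X A z s P B hP hz hall hsz w₁ (hS w₁ hw₁) w₂ (hS w₂ hw₂) w₃ (hS w₃ hw₃) hind
    (hSX w₁ hw₁) (hSX w₂ hw₂) (hSX w₃ hw₃) hd₁ hd₂ hd₃
  have hsv : z - B p' = s := by rw [hzp, add_sub_cancel_right]
  refine ⟨B '' (↑P : Set (EuclideanSpace ℝ (Fin 3))), B p', hmenu, ⟨p', Finset.mem_coe.2 hp', rfl⟩, ?_, ?_, ?_, ?_, ?_, ?_⟩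
  · rw [hsv]; exact hs
  · rw [hsv]; exact hs12
  · rintro v ⟨p, hp, rfl⟩
    rw [hsv]; exact hocc p (Finset.mem_coe.1 hp)
  · intro q hq hqd
    rw [hsv] at hqd ⊢
    obtain ⟨p, hp, hqp⟩ := hall q hq hqd
    exact ⟨p, Finset.mem_coe.2 hp, by rw [hqp, add_sub_cancel_left]⟩
  · rw [hsv]; exact hxs
  · rw [hsv]
    rcases hxcase with h | ⟨p, hp, h⟩
    · exact Or.inl h
    · exact Or.inr ⟨B p, ⟨p, Finset.mem_coe.2 hp, rfl⟩, h⟩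

/-- **Per end ball: all on the menu, or a payer within `2 + √3`.**  Under the hypotheses of `menu_or_payer_of_near_endBall`
at `z`: EITHER some `y ∈ X`, `y ≠ z`, `dist z y ≤ 2 + √3` has at most eleven contacts (a PAYER near `z`; one payer serves at
most `606` end balls, `card_filter_dist_le_two_add_sqrt_three_le_606`), OR every `x ∈ X`, `x ≠ z`, within `√3` of `z` is on
the docked menu of the grain (second alternative of `menu_or_payer_of_near_endBall`). -/
theorem allOnMenu_or_payer_near_endBall {δ : ℝ} (hg : KissingGap δ) (hc : KissingClassification δ) (hδ : 5 / 2 ≤ δ)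
    (hX : ∀ p ∈ X, ∀ q ∈ X, p ≠ q → 1 ≤ dist p q)
    (A : EuclideanSpace ℝ (Fin 3) ≃ₗᵢ[ℝ] EuclideanSpace ℝ (Fin 3)) {z : EuclideanSpace ℝ (Fin 3)} (hz : z ∈ X)
    (S : Finset (EuclideanSpace ℝ (Fin 3))) (hS : ∀ w ∈ S, w ∈ fccSlots) (hSX : ∀ w ∈ S, z + A w ∈ X)
    (hdeg : (X.filter fun q => dist z q = 1).card ≤ S.card + 1) :
    (∃ y ∈ X, y ≠ z ∧ dist z y ≤ 2 + Real.sqrt 3 ∧ (X.filter fun q => dist y q = 1).card ≤ 11) ∨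
    ∀ x ∈ X, x ≠ z → dist x z ≤ Real.sqrt 3 →
      ∃ (D : Set (EuclideanSpace ℝ (Fin 3))) (v' : EuclideanSpace ℝ (Fin 3)),
        (D = A '' (↑fccSlots : Set (EuclideanSpace ℝ (Fin 3))) ∨
          ∃ n : EuclideanSpace ℝ (Fin 3), ‖n‖ = 1 ∧
            (∀ w ∈ fccSlots, ⟪A w, n⟫_ℝ = 0 ∨ ⟪A w, n⟫_ℝ = Real.sqrt (2 / 3) ∨ ⟪A w, n⟫_ℝ = -Real.sqrt (2 / 3)) ∧
            D = (fun w => A w) '' {w | w ∈ fccSlots ∧ ⟪A w, n⟫_ℝ ≤ 0} ∪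
              (fun w => A w - (2 * ⟪A w, n⟫_ℝ) • n) '' {w | w ∈ fccSlots ∧ ⟪A w, n⟫_ℝ < 0}) ∧
        v' ∈ D ∧ z - v' ∈ X ∧ (X.filter fun q => dist (z - v') q = 1).card = 12 ∧
        (∀ v ∈ D, z - v' + v ∈ X) ∧ (∀ q ∈ X, dist (z - v') q = 1 → q - (z - v') ∈ D) ∧
        dist x (z - v') ≤ 1 ∧ (x = z - v' ∨ ∃ v ∈ D, x = z - v' + v) := by
  by_cases h : ∃ y ∈ X, y ≠ z ∧ dist z y ≤ 2 + Real.sqrt 3 ∧ (X.filter fun q => dist y q = 1).card ≤ 11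
  · exact Or.inl h
  · right
    intro x hx hxz h3
    rcases menu_or_payer_of_near_endBall hg hc hδ hX A hz S hS hSX hdeg hx hxz h3 with ⟨y, hy, hyz, hxy, hy11⟩ | hm
    · exact (h ⟨y, hy, hyz, by
        calc dist z y ≤ dist z x + dist x y := dist_triangle _ _ _
          _ ≤ Real.sqrt 3 + 2 := add_le_add (by rw [dist_comm]; exact h3) hxy
          _ = 2 + Real.sqrt 3 := add_comm _ _, hy11⟩).elim
    · exact hm

end Summit.Ventures.Crystal3D.Theorems

end
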